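import Summits.QuantumFields.YangMills.Theorems.AllWindowsColdBoxBoxKernelHessianDecay
import Summits.QuantumFields.YangMills.Theorems.AllWindowsColdBoxTorusGreenGradientAllPoints

/-!
# `(1 + dist_∞)⁻³` decay of the first differences of the Dirichlet/Neumann box Green function in `d = 4`
# ((J′1) of STUB-PLAN-U1 rev 2 §6.3 / K1-T companion: LINE-18 stub K1 ⟨stmt-QuantumFields-24006⟩, LINE-19/20 S3b–U1 ⟨24004⟩/⟨24336⟩)

The 16-image formula `G_B = boxLap⁻¹ = ½ Σ_σ sgn(σ) G̃_{2M}(ι· − σ·ι·)` (`…BoxKernelGreen`) turns the tree's torus gradient bound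
(`TorusGreenGradient.torusGreen_grad_mul_dist_pow_three_le`, all points: `torusGreen_grad_le`) into gradient bounds for every D/N box, UP TO THE WALL:
* `boxGreen_grad_fst_eq` / `boxGreen_grad_snd_eq` — first differences in the evaluation point / in the source as signed sums of torus gradients at the
  images (a source shift moves the image by `∓e_b`);
* **`boxGreen_grad_fst_decay`, `boxGreen_grad_snd_decay`** — an absolute `C` with `|G_B(s+e_a, s') − G_B(s, s')|·(1 + |s_κ − s'_κ|)³ ≤ C` and
  `|G_B(s, s'+e_b) − G_B(s, s')|·(1 + |s_κ − s'_κ|)³ ≤ C` for all half-periods `M ≥ 1`, Dirichlet sets, directions and box points;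
* **`boxLap_inv_grad_fst_decay`, `boxLap_inv_grad_snd_decay`** — the same for the entries of `boxLap⁻¹` (nonempty Dirichlet set):
  `|L⁻¹(z+e_a, z') − L⁻¹(z, z')|, |L⁻¹(z, z'+e_b) − L⁻¹(z, z')| ≤ C (1 + |z − z'|_∞)^{−3}` uniformly in the box.
No definitions; standard axioms.

HONEST LABEL: helper toward the OPEN kernel stubs K1 / S3b / U1 of critic-passed lines on the R2ξ″ RECORD-rung cruxes 24006 / 24004 / 24336; no stub, crux,
rung or summit is proved here; the Yang–Mills mass gap is NOT proved by this file.
-/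

set_option autoImplicit false

noncomputable section

open Finset ZMod
open scoped Real BigOperators

namespace Summit.QuantumFields.YangMills.Theorems.AllWindowsColdBox.BoxKernel

open Literature.Probability.LatticeModels

variable {d : ℕ} {M : ℕ} [NeZero M] {Dset : Finset (Fin d)}

/-! ## First differences of the image sum -/

/-- First difference in the evaluation point: `G_B(y+e_a, y') − G_B(y, y') = ½ Σ_σ sgn(σ) (G̃(u_σ + e_a) − G̃(u_σ))`, `u_σ = ι y − σ·ι y'`. -/
theorem boxGreen_grad_fst_eq (y y' : Fin d → ℤ) (a : Fin d) :
    boxGreen M Dset (y + Pi.single a 1) y' - boxGreen M Dset y y' =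
      (1 / 2 : ℝ) * ∑ σ : Fin d → Bool, sgn Dset σ *
        (torusGreen (toTorus M y - refl M Dset σ (toTorus M y') + Pi.single a 1) - torusGreen (toTorus M y - refl M Dset σ (toTorus M y'))) := by
  unfold boxGreen imageSum
  rw [toTorus_add_single, Finset.mul_sum, Finset.mul_sum, Finset.mul_sum, ← Finset.sum_sub_distrib]
  refine Finset.sum_congr rfl fun σ _ => ?_
  have e : toTorus M y + Pi.single a 1 - refl M Dset σ (toTorus M y') = toTorus M y - refl M Dset σ (toTorus M y') + Pi.single a 1 := by abel
  rw [e]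
  ring

/-- First difference in the source: `G_B(y, y'+e_b) − G_B(y, y') = ½ Σ_σ sgn(σ)·(G̃(u_σ + e_b) − G̃(u_σ))` if `σ` flips `b`, and
`½ Σ_σ sgn(σ)·(−(G̃(u_σ) − G̃(u_σ − e_b)))` if it does not. -/
theorem boxGreen_grad_snd_eq (y y' : Fin d → ℤ) (b : Fin d) :
    boxGreen M Dset y (y' + Pi.single b 1) - boxGreen M Dset y y' =
      (1 / 2 : ℝ) * ∑ σ : Fin d → Bool, sgn Dset σ *
        (if σ b then
          (torusGreen (toTorus M y - refl M Dset σ (toTorus M y') + Pi.single b 1) - torusGreen (toTorus M y - refl M Dset σ (toTorus M y')))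
        else
          -(torusGreen (toTorus M y - refl M Dset σ (toTorus M y')) - torusGreen (toTorus M y - refl M Dset σ (toTorus M y') - Pi.single b 1))) := by
  unfold boxGreen imageSum
  rw [toTorus_add_single, Finset.mul_sum, Finset.mul_sum, Finset.mul_sum, ← Finset.sum_sub_distrib]
  refine Finset.sum_congr rfl fun σ _ => ?_
  rw [refl_add_single]
  by_cases hσ : σ b = true
  · simp only [hσ, if_true]
    have e : toTorus M y - (refl M Dset σ (toTorus M y') + -Pi.single b 1) = toTorus M y - refl M Dset σ (toTorus M y') + Pi.single b 1 := by abel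
    rw [e]
    ring
  · simp only [hσ, Bool.false_eq_true, if_false]
    have e : toTorus M y - (refl M Dset σ (toTorus M y') + Pi.single b 1) = toTorus M y - refl M Dset σ (toTorus M y') - Pi.single b 1 := by abel
    rw [e]
    ring

/-! ## The gradient estimates (d = 4) -/

/-- Per-image bound: if the `κ`-coordinate of `z` is the class of `y_κ − r + δ` (`r` one of the three images of `y'_κ`, `|δ| ≤ 1`), then
`|G̃(z + e_i) − G̃(z)|·(1 + |y_κ − y'_κ|)³ ≤ 27 C₁`, `C₁` the constant of `torusGreen_grad_le`. -/
theorem torusGreen_grad_image_le {C₁ : ℝ}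
    (hG : ∀ (L : ℕ) [NeZero L] (i : Fin 4) (z : TorusSite 4 L),
      |torusGreen (z + Pi.single i 1) - torusGreen z| * (max 1 (Real.sqrt (∑ k, (((z k).valMinAbs : ℤ) : ℝ) ^ 2))) ^ 3 ≤ C₁)
    {M : ℕ} [NeZero M] {Dset : Finset (Fin 4)} (s s' : Box 4 M Dset) (κ i : Fin 4) (σ : Fin 4 → Bool) (z : TorusSite 4 (2 * M))
    (δ : ℤ) (hδ0 : -1 ≤ δ) (hδ1 : δ ≤ 1)
    (hz : z κ = (((coords s κ - (if σ κ then (if κ ∈ Dset then -coords s' κ else -1 - coords s' κ) else coords s' κ) + δ : ℤ)) :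
      ZMod (2 * M))) :
    |torusGreen (z + Pi.single i 1) - torusGreen z| * (1 + |(((s.1 κ : ℕ) : ℝ)) - ((s'.1 κ : ℕ) : ℝ)|) ^ 3 ≤ 27 * C₁ := by
  set n : ℝ := |(((s.1 κ : ℕ) : ℝ)) - ((s'.1 κ : ℕ) : ℝ)| with hn
  have hnint : n = (( |coords s κ - coords s' κ| : ℤ) : ℝ) := by rw [hn]; simp [coords]
  have hs0 : 0 ≤ coords s κ := by simp [coords]
  have hsM : coords s κ < M := by simp only [coords]; exact_mod_cast (s.1 κ).isLt
  have hs0' : 0 ≤ coords s' κ := by simp [coords]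
  have hsM' : coords s' κ < M := by simp only [coords]; exact_mod_cast (s'.1 κ).isLt
  have hGz := hG (2 * M) i z
  have hfar : (( |coords s κ - coords s' κ| : ℤ) : ℝ) - 1 ≤ Real.sqrt (∑ k, (((z k).valMinAbs : ℤ) : ℝ) ^ 2) := by
    refine le_trans ?_ (abs_valMinAbs_le_dist z κ)
    rw [hz, ← Int.cast_one, ← Int.cast_sub, ← Int.cast_abs, Int.cast_le]
    refine le_abs_valMinAbs_of_forall (2 * M) _ _ fun j => ?_
    have hm : (coords s κ - (if σ κ then (if κ ∈ Dset then -coords s' κ else -1 - coords s' κ) else coords s' κ)) = coords s κ - coords s' κ ∨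
        (coords s κ - (if σ κ then (if κ ∈ Dset then -coords s' κ else -1 - coords s' κ) else coords s' κ)) = coords s κ + coords s' κ ∨
        (coords s κ - (if σ κ then (if κ ∈ Dset then -coords s' κ else -1 - coords s' κ) else coords s' κ)) = coords s κ + coords s' κ + 1 := by
      split_ifs
      · right; left; ring
      · right; right; ring
      · left; rfl
    exact repr_bound hs0 hsM hs0' hsM' hδ0 hδ1 hm j
  rw [← hnint] at hfar
  have hmax : 1 + n ≤ 3 * max 1 (Real.sqrt (∑ k, (((z k).valMinAbs : ℤ) : ℝ) ^ 2)) := by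
    rcases le_or_gt 2 n with h2 | h2
    · calc 1 + n ≤ 3 * (n - 1) := by linarith
        _ ≤ 3 * max 1 (Real.sqrt (∑ k, (((z k).valMinAbs : ℤ) : ℝ) ^ 2)) :=
            mul_le_mul_of_nonneg_left (hfar.trans (le_max_right _ _)) (by norm_num)
    · have hn0 : 0 ≤ n := abs_nonneg _
      calc 1 + n ≤ 3 * 1 := by linarith
        _ ≤ 3 * max 1 (Real.sqrt (∑ k, (((z k).valMinAbs : ℤ) : ℝ) ^ 2)) :=
            mul_le_mul_of_nonneg_left (le_max_left _ _) (by norm_num)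
  have hn0 : 0 ≤ n := abs_nonneg _
  have hpow : (1 + n) ^ 3 ≤ 27 * (max 1 (Real.sqrt (∑ k, (((z k).valMinAbs : ℤ) : ℝ) ^ 2))) ^ 3 := by
    calc (1 + n) ^ 3 ≤ (3 * max 1 (Real.sqrt (∑ k, (((z k).valMinAbs : ℤ) : ℝ) ^ 2))) ^ 3 := pow_le_pow_left₀ (by linarith) hmax 3
      _ = 27 * (max 1 (Real.sqrt (∑ k, (((z k).valMinAbs : ℤ) : ℝ) ^ 2))) ^ 3 := by ring
  calc |torusGreen (z + Pi.single i 1) - torusGreen z| * (1 + n) ^ 3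
        ≤ |torusGreen (z + Pi.single i 1) - torusGreen z| * (27 * (max 1 (Real.sqrt (∑ k, (((z k).valMinAbs : ℤ) : ℝ) ^ 2))) ^ 3) :=
        mul_le_mul_of_nonneg_left hpow (abs_nonneg _)
    _ = 27 * (|torusGreen (z + Pi.single i 1) - torusGreen z| * (max 1 (Real.sqrt (∑ k, (((z k).valMinAbs : ℤ) : ℝ) ^ 2))) ^ 3) := by ring
    _ ≤ 27 * C₁ := mul_le_mul_of_nonneg_left hGz (by norm_num)

/-- **Gradient decay in the evaluation point**: `|G_B(s+e_a, s') − G_B(s, s')|·(1 + |s_κ − s'_κ|)³ ≤ C`, uniformly in the box. -/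
theorem boxGreen_grad_fst_decay : ∃ C : ℝ, 0 ≤ C ∧ ∀ (M : ℕ) [NeZero M] (Dset : Finset (Fin 4)) (a κ : Fin 4) (s s' : Box 4 M Dset),
    |boxGreen M Dset (coords s + Pi.single a 1) (coords s') - boxGreen M Dset (coords s) (coords s')| *
      (1 + |(((s.1 κ : ℕ) : ℝ)) - ((s'.1 κ : ℕ) : ℝ)|) ^ 3 ≤ C := by
  obtain ⟨C₁, hC₁0, hG⟩ := torusGreen_grad_le
  refine ⟨216 * C₁, by positivity, ?_⟩
  intro M _ Dset a κ s s'
  set n : ℝ := |(((s.1 κ : ℕ) : ℝ)) - ((s'.1 κ : ℕ) : ℝ)| with hn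
  rw [boxGreen_grad_fst_eq]
  set T : (Fin 4 → Bool) → ℝ := fun σ =>
    torusGreen (toTorus M (coords s) - refl M Dset σ (toTorus M (coords s')) + Pi.single a 1) -
      torusGreen (toTorus M (coords s) - refl M Dset σ (toTorus M (coords s'))) with hT
  have hTσ : ∀ σ : Fin 4 → Bool, |T σ| * (1 + n) ^ 3 ≤ 27 * C₁ := by
    intro σ
    refine torusGreen_grad_image_le hG s s' κ a σ _ 0 (by norm_num) zero_le_one ?_
    rw [sub_refl_apply]; simp
  have h12 : (0 : ℝ) < 1 / 2 := by norm_num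
  calc |(1 / 2 : ℝ) * ∑ σ : Fin 4 → Bool, sgn Dset σ * T σ| * (1 + n) ^ 3
        = (1 / 2 : ℝ) * (|∑ σ : Fin 4 → Bool, sgn Dset σ * T σ| * (1 + n) ^ 3) := by rw [abs_mul, abs_of_pos h12, mul_assoc]
    _ ≤ (1 / 2 : ℝ) * ((∑ σ : Fin 4 → Bool, |sgn Dset σ * T σ|) * (1 + n) ^ 3) :=
        mul_le_mul_of_nonneg_left (mul_le_mul_of_nonneg_right (Finset.abs_sum_le_sum_abs _ _) (by positivity)) h12.le
    _ = (1 / 2 : ℝ) * ∑ σ : Fin 4 → Bool, |T σ| * (1 + n) ^ 3 := by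
        rw [Finset.sum_mul]; congr 1
        exact Finset.sum_congr rfl fun σ _ => by rw [abs_mul, abs_sgn, one_mul]
    _ ≤ (1 / 2 : ℝ) * ∑ σ : Fin 4 → Bool, (27 * C₁ : ℝ) := mul_le_mul_of_nonneg_left (Finset.sum_le_sum fun σ _ => hTσ σ) h12.le
    _ = 216 * C₁ := by
        rw [Finset.sum_const, Finset.card_univ, Fintype.card_fun, Fintype.card_bool, Fintype.card_fin, nsmul_eq_mul]
        push_cast; ring

/-- **Gradient decay in the source**: `|G_B(s, s'+e_b) − G_B(s, s')|·(1 + |s_κ − s'_κ|)³ ≤ C`, uniformly in the box. -/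
theorem boxGreen_grad_snd_decay : ∃ C : ℝ, 0 ≤ C ∧ ∀ (M : ℕ) [NeZero M] (Dset : Finset (Fin 4)) (b κ : Fin 4) (s s' : Box 4 M Dset),
    |boxGreen M Dset (coords s) (coords s' + Pi.single b 1) - boxGreen M Dset (coords s) (coords s')| *
      (1 + |(((s.1 κ : ℕ) : ℝ)) - ((s'.1 κ : ℕ) : ℝ)|) ^ 3 ≤ C := by
  obtain ⟨C₁, hC₁0, hG⟩ := torusGreen_grad_le
  refine ⟨216 * C₁, by positivity, ?_⟩
  intro M _ Dset b κ s s'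
  set n : ℝ := |(((s.1 κ : ℕ) : ℝ)) - ((s'.1 κ : ℕ) : ℝ)| with hn
  rw [boxGreen_grad_snd_eq]
  set T : (Fin 4 → Bool) → ℝ := fun σ =>
    if σ b then
      (torusGreen (toTorus M (coords s) - refl M Dset σ (toTorus M (coords s')) + Pi.single b 1) -
        torusGreen (toTorus M (coords s) - refl M Dset σ (toTorus M (coords s'))))
    else
      -(torusGreen (toTorus M (coords s) - refl M Dset σ (toTorus M (coords s'))) -
        torusGreen (toTorus M (coords s) - refl M Dset σ (toTorus M (coords s')) - Pi.single b 1)) with hT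
  have hTσ : ∀ σ : Fin 4 → Bool, |T σ| * (1 + n) ^ 3 ≤ 27 * C₁ := by
    intro σ
    set u : TorusSite 4 (2 * M) := toTorus M (coords s) - refl M Dset σ (toTorus M (coords s')) with hu
    by_cases hσ : σ b = true
    · simp only [hT, hσ, if_true]
      refine torusGreen_grad_image_le hG s s' κ b σ u 0 (by norm_num) zero_le_one ?_
      rw [hu, sub_refl_apply]; simp
    · simp only [hT, hσ, Bool.false_eq_true, if_false, abs_neg]
      have h := torusGreen_grad_image_le hG s s' κ b σ (u - Pi.single b 1) (if κ = b then -1 else 0)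
        (by split_ifs <;> norm_num) (by split_ifs <;> norm_num) (by
          rw [Pi.sub_apply, hu, sub_refl_apply]
          by_cases hκb : κ = b
          · subst hκb; simp; ring
          · simp [hκb])
      rwa [sub_add_cancel, hu] at h
  have h12 : (0 : ℝ) < 1 / 2 := by norm_num
  calc |(1 / 2 : ℝ) * ∑ σ : Fin 4 → Bool, sgn Dset σ * T σ| * (1 + n) ^ 3
        = (1 / 2 : ℝ) * (|∑ σ : Fin 4 → Bool, sgn Dset σ * T σ| * (1 + n) ^ 3) := by rw [abs_mul, abs_of_pos h12, mul_assoc]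
    _ ≤ (1 / 2 : ℝ) * ((∑ σ : Fin 4 → Bool, |sgn Dset σ * T σ|) * (1 + n) ^ 3) :=
        mul_le_mul_of_nonneg_left (mul_le_mul_of_nonneg_right (Finset.abs_sum_le_sum_abs _ _) (by positivity)) h12.le
    _ = (1 / 2 : ℝ) * ∑ σ : Fin 4 → Bool, |T σ| * (1 + n) ^ 3 := by
        rw [Finset.sum_mul]; congr 1
        exact Finset.sum_congr rfl fun σ _ => by rw [abs_mul, abs_sgn, one_mul]
    _ ≤ (1 / 2 : ℝ) * ∑ σ : Fin 4 → Bool, (27 * C₁ : ℝ) := mul_le_mul_of_nonneg_left (Finset.sum_le_sum fun σ _ => hTσ σ) h12.le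
    _ = 216 * C₁ := by
        rw [Finset.sum_const, Finset.card_univ, Fintype.card_fun, Fintype.card_bool, Fintype.card_fin, nsmul_eq_mul]
        push_cast; ring

/-- **Gradient decay of `boxLap⁻¹` in the first index** (nonempty Dirichlet set): for box points `s`, `t = s + e_a`, `s'`,
`|L⁻¹(t, s') − L⁻¹(s, s')|·(1 + |s_κ − s'_κ|)³ ≤ C`. -/
theorem boxLap_inv_grad_fst_decay : ∃ C : ℝ, 0 ≤ C ∧ ∀ (M : ℕ) [NeZero M] (Dset : Finset (Fin 4)), Dset.Nonempty →
    ∀ (a κ : Fin 4) (s t s' : Box 4 M Dset), coords t = coords s + Pi.single a 1 →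
    |(boxLap M Dset)⁻¹ t s' - (boxLap M Dset)⁻¹ s s'| * (1 + |(((s.1 κ : ℕ) : ℝ)) - ((s'.1 κ : ℕ) : ℝ)|) ^ 3 ≤ C := by
  obtain ⟨C, hC0, hC⟩ := boxGreen_grad_fst_decay
  refine ⟨C, hC0, ?_⟩
  intro M _ Dset hD a κ s t s' ht
  rw [boxLap_inv_eq hD]
  simp only [boxGreenMat, Matrix.of_apply, ht]
  exact hC M Dset a κ s s'

/-- **Gradient decay of `boxLap⁻¹` in the second index** (nonempty Dirichlet set): for box points `s`, `s'`, `t' = s' + e_b`,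
`|L⁻¹(s, t') − L⁻¹(s, s')|·(1 + |s_κ − s'_κ|)³ ≤ C`. -/
theorem boxLap_inv_grad_snd_decay : ∃ C : ℝ, 0 ≤ C ∧ ∀ (M : ℕ) [NeZero M] (Dset : Finset (Fin 4)), Dset.Nonempty →
    ∀ (b κ : Fin 4) (s s' t' : Box 4 M Dset), coords t' = coords s' + Pi.single b 1 →
    |(boxLap M Dset)⁻¹ s t' - (boxLap M Dset)⁻¹ s s'| * (1 + |(((s.1 κ : ℕ) : ℝ)) - ((s'.1 κ : ℕ) : ℝ)|) ^ 3 ≤ C := by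
  obtain ⟨C, hC0, hC⟩ := boxGreen_grad_snd_decay
  refine ⟨C, hC0, ?_⟩
  intro M _ Dset hD b κ s s' t' ht'
  rw [boxLap_inv_eq hD]
  simp only [boxGreenMat, Matrix.of_apply, ht']
  exact hC M Dset b κ s s'

end Summit.QuantumFields.YangMills.Theorems.AllWindowsColdBox.BoxKernel

end
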